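import Literature.AlgebraicGeometry.HodgeTheory.DiagonalTorusFamily
import Literature.AlgebraicGeometry.HodgeTheory.CyclicCoverDeckIsMonodromy
import HarnessLib

/-!
# The untwisting map of the diagonal-torus family and the transport along the torus path

Family `hodge`, layer `Literature/AlgebraicGeometry/HodgeTheory`; theorems and concrete definitions only (no named
fact). Written by the prover seat `hodge-nonav-19716-p2` (g6) for crux K1-B `VeryGeneralSignCommutatorsInHg`
(stmt-HodgeConjecture-19716), second file after `DiagonalTorusFamily`. THE TORUS TRICK, analytic half: for a
nonsingular form `F` of degree `d` in `x₀, …, x_{n+1}` and a diagonal symmetry `a ∈ diagonalStabilizer F`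
(`F(a • x) = F(x)`), the torus family `b ↦ X_{F(b • x)}` (`DiagonalTorus.torusFamily`) is trivialised GLOBALLY over
`B = {t | ∀ i, bᵢ(t) ≠ 0}` by `[z] ↦ [b • z] ∈ X_F` (no branch cuts — contrast the cyclic-cover case
`CyclicCoverScaling*`, parametrised by the coefficient `λ = b^p`), so parallel transport in `Rᵏ u_* ℂ` along the torus
path `s ↦ b_s = exp(s · log a)` from `b = 1` to `b = a` takes `e₁^* α` to `e₂^* (g_a^* α)`, `g_a = diagonalAut F a`,
for the embedding-compatible identifications `e₁ : 𝒴_{T,1} ≅ X_F`, `e₂ : 𝒴_{T,a} ≅ X_F`: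

* §1 homogeneous coordinates on the torus family (`totalProj`), the form of a point in terms of its parameter
  vector (`pointFormSpz_eq_twist`), the scaling `unitScale` of homogeneous coordinates and the untwisting map
  `untwist : [z] ↦ [b(t) • z]` of the tube over `B` (continuous, prescribed coordinates);
* §2 `exists_compatible_iso_torusPoint`, **`transportFun_torusPath`** (`transportFun_fiberRestrict` with the tube
  class `untwist^* α`; on the end fibres the untwisting map is `e₁` resp. `g_a ∘ e₂`).

The push-down to the universal family and to monomial-supported families is in `DiagonalTorusMonodromy`.

## References

* [Katz2009] N. M. Katz, Another look at the Dwork family, Progr. Math. 269 (2009), §3.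
* [CarlsonToledo1999] J. A. Carlson, D. Toledo, Discriminant complements and kernels of monodromy representations,
  Duke Math. J. 97 (1999), §2.
* [VoisinHodgeII2003] C. Voisin, Hodge Theory and Complex Algebraic Geometry II, CUP 2003, §3.1.2, §6.2.1.
* [SerreGAGA1956] J.-P. Serre, GAGA, Ann. Inst. Fourier 6 (1956), §2 n°5.
* [Hartshorne1977] R. Hartshorne, Algebraic Geometry (1977), II Example 7.1.1.
-/

noncomputable section

namespace Literature.AlgebraicGeometry.HodgeTheory

open CategoryTheory _root_.AlgebraicGeometry MvPolynomial
open _root_.Topology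
open Literature.AlgebraicGeometry.Motives Literature.AlgebraicGeometry.Motives.UniversalHypersurface
open Literature.AlgebraicGeometry.HodgeTheory.UniversalHypersurface
open Literature.AlgebraicTopology.SingularHomology
open Literature.NumberTheory.Transcendental
open scoped LinearAlgebra.Projectivization

namespace DiagonalTorus

/-! ### §1 Homogeneous coordinates on the torus family and the untwisting map -/

section Coordinates

variable {n : ℕ} (d : ℕ) (F : MvPolynomial (Fin (n + 2)) ℂ)

/-- Homogeneous coordinates `[z₀ : … : z_{n+1}]` of a complex point of the total space of the torus family.
[cite: SerreGAGA1956, §2 n°5] -/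
def totalProj (y : ComplexPoints (torusTotal d F)) : ℙ ℂ (Fin (n + 2) → ℂ) :=
  hypersurfacePoint (totalToProjectiveSpace d F) y

/-- `totalProj` is continuous. [cite: SerreGAGA1956, §2 n°5] -/
theorem continuous_totalProj : Continuous (totalProj d F) := continuous_hypersurfacePoint _

/-- Homogeneous coordinates commute with composition of the structure maps. [cite: SerreGAGA1956, §2 n°5] -/
theorem hypersurfacePoint_comp {Y Z : SchemeOver ℂ} (g : Y ⟶ Z) (ι : Z ⟶ Motives.projectiveSpace (n + 1) ℂ)
    (P : ComplexPoints Y) : hypersurfacePoint (g ≫ ι) P = hypersurfacePoint ι (AlgPoints.map g P) :=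
  hypersurfacePoint_eq_of_projPoint_eq _ _ (by rw [projPoint_hypersurfacePoint, AlgPoints.map_comp_apply])

/-- The coefficient homomorphism of a point `t` of `S_T` is evaluation at its parameter vector (as `ℂ`-algebra
maps). [cite: VoisinHodgeII2003, §6.2.1] -/
theorem pointAlgHomSpz_eq_evalAt (t : ComplexPoints (torusBase d F)) :
    pointAlgHomSpz ℂ n d (torusSpz d F) t = evalAt (param d F t) :=
  MvPolynomial.algHom_ext fun i => by rw [evalAt_X]; rfl

variable {d F} in
/-- **The form of a point of `S_T` with invertible parameter vector `b` is the twisted form `F(b • x)`.**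
[cite: Katz2009, §3] -/
theorem pointFormSpz_eq_twist (hF : F.IsHomogeneous d) (t : ComplexPoints (torusBase d F)) (b : Fin (n + 2) → ℂˣ)
    (hb : param d F t = fun i => (b i : ℂ)) :
    pointFormSpz ℂ n d (torusSpz d F) t = aeval (diagonalSubst b) F := by
  refine eq_of_coeffHom_eq (isHomogeneous_pointForm ℂ n d _) (isHomogeneous_twist d hF b) ?_
  rw [← pointAlgHomSpz_comp, pointAlgHomSpz_eq_evalAt, hb, evalAt_comp_torusSpz]

/-- **The homogeneous coordinates of a point of `𝒴_T` over `t` satisfy the equation of the form of `t`.**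
[cite: VoisinHodgeII2003, §6.2.1] -/
theorem totalProj_mem_projZeroLocus (hd : 0 < d) (y : ComplexPoints (torusTotal d F)) :
    totalProj d F y ∈ Projectivization.projZeroLocus
      {pointFormSpz ℂ n d (torusSpz d F) (AlgPoints.map (torusFamily d F) y)} := by
  generalize ht : AlgPoints.map (torusFamily d F) y = t
  have hy : y ∈ AlgPoints.map (torusFamily d F) ⁻¹' {t} := ht
  rw [← AlgPoints.range_map_fiberι] at hy
  obtain ⟨y', rfl⟩ := hy
  obtain ⟨e, he⟩ := CyclicCoverScaling.exists_fiberIsoSpz_comp hd (torusSpz d F) t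
  have h1 : totalProj d F (AlgPoints.map (fiberι (torusFamily d F) t) y') =
      hypersurfacePoint (SmoothHypersurface.hypersurfaceι (pointFormSpz ℂ n d (torusSpz d F) t))
        (AlgPoints.map e.hom y') := by
    rw [totalProj, ← hypersurfacePoint_comp, ← hypersurfacePoint_comp, he]
  rw [h1]
  haveI := SmoothHypersurface.isClosedImmersion_hypersurfaceι_left (pointFormSpz ℂ n d (torusSpz d F) t)
  exact hypersurfacePoint_mem_projZeroLocus (isHomogeneous_pointForm ℂ n d _)
    (SmoothHypersurface.range_hypersurfaceι _) _

/-- The open set `B ⊆ S_T(ℂ)` of points with invertible parameter vector. [cite: Katz2009, §3] -/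
def goodSet : Set (ComplexPoints (torusBase d F)) := {t | ∀ i, param d F t i ≠ 0}

/-- `B` is open. [cite: SerreGAGA1956, §2 n°5] -/
theorem isOpen_goodSet : IsOpen (goodSet d F) := by
  have : goodSet d F = ⋂ i, {t | param d F t i ≠ 0} := by
    ext t; simp [goodSet]
  rw [this]
  exact isOpen_iInter_of_finite fun i =>
    (isOpen_compl_singleton (x := (0 : ℂ))).preimage ((continuous_apply i).comp (continuous_param d F))

variable {d F} in
/-- Points `b ∈ (ℂ^×)^{n+2}` lie in `B`. [cite: Katz2009, §3] -/
theorem torusPoint_mem_goodSet (hF : F.IsHomogeneous d) (hJ : SmoothHypersurface.IsNonsingularForm ℂ F)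
    (b : Fin (n + 2) → ℂˣ) : torusPoint hF hJ b ∈ goodSet d F := fun i => by
  rw [param_torusPoint]; exact (b i).ne_zero

/-- The parameter vector of `t ∈ B` as a vector of units. [cite: Katz2009, §3] -/
def paramUnits (t : ComplexPoints (torusBase d F)) (ht : t ∈ goodSet d F) : Fin (n + 2) → ℂˣ :=
  fun i => Units.mk0 (param d F t i) (ht i)

/-- `paramUnits` has the parameter vector as its values. [cite: Katz2009, §3] -/
theorem val_paramUnits (t : ComplexPoints (torusBase d F)) (ht : t ∈ goodSet d F) :
    (fun i => (paramUnits d F t ht i : ℂ)) = param d F t := rfl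

variable {d F} in
/-- At the point `b` the unit parameter vector is `b`. [cite: Katz2009, §3] -/
theorem paramUnits_torusPoint (hF : F.IsHomogeneous d) (hJ : SmoothHypersurface.IsNonsingularForm ℂ F)
    (b : Fin (n + 2) → ℂˣ) (ht : torusPoint hF hJ b ∈ goodSet d F) :
    paramUnits d F (torusPoint hF hJ b) ht = b := by
  funext i; ext
  rw [paramUnits, Units.val_mk0, param_torusPoint]

/-- **Scaling homogeneous coordinates by a diagonal unit**: `[z] ↦ [a • z]` on `ℙ(ℂⁿ⁺²)`.
[cite: Hartshorne1977, II Example 7.1.1] -/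
def unitScale (a : Fin (n + 2) → ℂˣ) (q : ℙ ℂ (Fin (n + 2) → ℂ)) : ℙ ℂ (Fin (n + 2) → ℂ) :=
  Projectivization.mk ℂ (a • q.rep) ((smul_ne_zero_iff_ne a).mpr (Projectivization.rep_nonzero q))

/-- `[a • z] = unitScale a [z]`. [cite: Hartshorne1977, II Example 7.1.1] -/
theorem unitScale_mk (a : Fin (n + 2) → ℂˣ) (v : Fin (n + 2) → ℂ) (hv : v ≠ 0) :
    unitScale a (Projectivization.mk ℂ v hv) = Projectivization.mk ℂ (a • v) ((smul_ne_zero_iff_ne a).mpr hv) := by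
  rw [unitScale, Projectivization.mk_eq_mk_iff']
  obtain ⟨c, hc⟩ := Projectivization.exists_smul_eq_mk_rep ℂ v hv
  refine ⟨(c : ℂ), ?_⟩
  rw [← hc, Units.smul_def, smul_comm]

/-- `unitScale 1 = id`. [cite: Hartshorne1977, II Example 7.1.1] -/
@[simp] theorem unitScale_one (q : ℙ ℂ (Fin (n + 2) → ℂ)) : unitScale 1 q = q := by
  rw [unitScale]; simp only [one_smul, Projectivization.mk_rep]

/-- **Joint continuity of `(x, q) ↦ [a(x) • q]`** for a continuous family of diagonal units (test after the open
quotient map `𝟙 × (v ↦ [v])`). [cite: SerreGAGA1956, §2 n°5] -/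
theorem continuous_unitScale₂ {X : Type*} [TopologicalSpace X] {a : X → Fin (n + 2) → ℂˣ}
    (ha : Continuous fun x => fun i => ((a x i : ℂˣ) : ℂ)) {q : X → ℙ ℂ (Fin (n + 2) → ℂ)} (hq : Continuous q) :
    Continuous fun x => unitScale (a x) (q x) := by
  have hΦ : Continuous fun z : X × ℙ ℂ (Fin (n + 2) → ℂ) => unitScale (a z.1) z.2 := by
    have hQ : IsOpenQuotientMap
        (Prod.map (@id X) fun v : {v : Fin (n + 2) → ℂ // v ≠ 0} => Projectivization.mk ℂ v.1 v.2) :=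
      IsOpenQuotientMap.id.prodMap Projectivization.isOpenQuotientMap_mk
    rw [hQ.isQuotientMap.continuous_iff]
    have h0 : ∀ z : X × {v : Fin (n + 2) → ℂ // v ≠ 0}, a z.1 • z.2.1 ≠ 0 := fun z =>
      (smul_ne_zero_iff_ne _).mpr z.2.2
    have heq : ((fun z : X × ℙ ℂ (Fin (n + 2) → ℂ) => unitScale (a z.1) z.2) ∘
        Prod.map (@id X) fun v : {v : Fin (n + 2) → ℂ // v ≠ 0} => Projectivization.mk ℂ v.1 v.2) =
        fun z => Projectivization.mk ℂ (a z.1 • z.2.1) (h0 z) := by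
      funext z
      exact unitScale_mk _ _ _
    rw [heq]
    have hc : Continuous fun z : X × {v : Fin (n + 2) → ℂ // v ≠ 0} => a z.1 • z.2.1 := by
      refine continuous_pi fun i => ?_
      simp only [smul_apply_eq_mul]
      exact ((continuous_apply i).comp (ha.comp continuous_fst)).mul
        ((continuous_apply i).comp (continuous_subtype_val.comp continuous_snd))
    exact Projectivization.continuous_mk.comp (hc.subtype_mk h0)
  exact hΦ.comp (continuous_id.prodMk hq)

/-- **Scaling by `b` carries the zeros of `F(b • x)` to the zeros of `F`.** [cite: Katz2009, §3] -/
theorem unitScale_mem_projZeroLocus (hF : F.IsHomogeneous d) (b : Fin (n + 2) → ℂˣ) {q : ℙ ℂ (Fin (n + 2) → ℂ)}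
    (hq : q ∈ Projectivization.projZeroLocus {aeval (diagonalSubst b) F}) :
    unitScale b q ∈ Projectivization.projZeroLocus {F} := by
  have hq' : MvPolynomial.eval q.rep (aeval (diagonalSubst b) F) = 0 := hq _ rfl
  rw [eval_aeval_diagonalSubst] at hq'
  by_cases hF0 : F = 0
  · subst hF0; intro G hG; rw [Set.mem_singleton_iff.mp hG, map_zero]
  have hS : ∀ G ∈ ({F} : Set (MvPolynomial (Fin (n + 2)) ℂ)), G.IsHomogeneous G.totalDegree := by
    rintro G rfl; rw [hF.totalDegree hF0]; exact hF
  rw [unitScale, Projectivization.mem_projZeroLocus_mk_iff hS]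
  rintro G rfl
  exact hq'

/-- The complex points of the model `X_F` are the projective zeros of `F`, homeomorphically (the embedding
`hypersurfacePoint`). [cite: SerreGAGA1956, §2 n°5] -/
def modelHomeomorph : ComplexPoints (SmoothHypersurface.hypersurface F) ≃ₜ
    Set.range (hypersurfacePoint (SmoothHypersurface.hypersurfaceι F)) :=
  haveI := SmoothHypersurface.isClosedImmersion_hypersurfaceι_left F
  (isEmbedding_hypersurfacePoint (SmoothHypersurface.hypersurfaceι F)).toHomeomorph

/-- The range of the coordinates of `X_F` is `V(F)`. [cite: SerreGAGA1956, §2 n°5] -/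
theorem range_modelPoint (hF : F.IsHomogeneous d) :
    Set.range (hypersurfacePoint (SmoothHypersurface.hypersurfaceι F)) = Projectivization.projZeroLocus {F} :=
  haveI := SmoothHypersurface.isClosedImmersion_hypersurfaceι_left F
  range_hypersurfacePoint hF (SmoothHypersurface.range_hypersurfaceι _)

variable {d F}

/-- The untwisted point's coordinates `[b(t) • z]` lie on `X_F`. [cite: Katz2009, §3] -/
theorem untwist_mem (hF : F.IsHomogeneous d) (hd : 0 < d) (y : tubeOver (torusFamily d F) (goodSet d F)) :
    unitScale (paramUnits d F (AlgPoints.map (torusFamily d F) y.1) y.2) (totalProj d F y.1) ∈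
      Set.range (hypersurfacePoint (SmoothHypersurface.hypersurfaceι F)) := by
  rw [range_modelPoint d F hF]
  refine unitScale_mem_projZeroLocus d F hF _ ?_
  rw [← pointFormSpz_eq_twist hF (AlgPoints.map (torusFamily d F) y.1) _ (val_paramUnits d F _ y.2).symm]
  exact totalProj_mem_projZeroLocus d F hd y.1

/-- **The untwisting map of the tube over `B`**: a point `y` of `𝒴_T` over `t` with coordinates `[z]` goes to the
point `[b(t) • z]` of `X_F` — the global algebraic trivialisation `x ↦ b • x` of the torus family over `B`.
[cite: Katz2009, §3] -/
def untwist (hF : F.IsHomogeneous d) (hd : 0 < d) (y : tubeOver (torusFamily d F) (goodSet d F)) :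
    ComplexPoints (SmoothHypersurface.hypersurface F) :=
  (modelHomeomorph F).symm ⟨_, untwist_mem hF hd y⟩

/-- **Coordinates of the untwisted point**: `[b(t) • z]`. [cite: Katz2009, §3] -/
theorem hypersurfacePoint_untwist (hF : F.IsHomogeneous d) (hd : 0 < d) (y : tubeOver (torusFamily d F) (goodSet d F)) :
    hypersurfacePoint (SmoothHypersurface.hypersurfaceι F) (untwist hF hd y) =
      unitScale (paramUnits d F (AlgPoints.map (torusFamily d F) y.1) y.2) (totalProj d F y.1) := by
  have h := congrArg Subtype.val ((modelHomeomorph F).apply_symm_apply ⟨_, untwist_mem hF hd y⟩)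
  rw [modelHomeomorph, IsEmbedding.toHomeomorph_apply_coe] at h
  exact h

/-- **The untwisting map is continuous.** [cite: SerreGAGA1956, §2 n°5] -/
theorem continuous_untwist (hF : F.IsHomogeneous d) (hd : 0 < d) : Continuous (untwist hF hd) := by
  refine (modelHomeomorph F).symm.continuous.comp (Continuous.subtype_mk ?_ _)
  refine continuous_unitScale₂ ?_ ((continuous_totalProj d F).comp continuous_subtype_val)
  have hΛ : Continuous fun y : tubeOver (torusFamily d F) (goodSet d F) =>
      param d F (AlgPoints.map (torusFamily d F) y.1) :=
    (continuous_param d F).comp ((AlgPoints.continuous_map _).comp continuous_subtype_val)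
  exact hΛ

/-- The untwisting map as a continuous map of the tube. [cite: SerreGAGA1956, §2 n°5] -/
def untwistC (hF : F.IsHomogeneous d) (hd : 0 < d) :
    C(tubeOver (torusFamily d F) (goodSet d F), ComplexPoints (SmoothHypersurface.hypersurface F)) :=
  ⟨untwist hF hd, continuous_untwist hF hd⟩

/-- Two continuous maps into `X_F(ℂ)` with the same homogeneous coordinates are equal. [cite: SerreGAGA1956, §2 n°5] -/
theorem continuousMap_eq_of_hypersurfacePoint_eq {Z : Type*} [TopologicalSpace Z]
    {g h : C(Z, ComplexPoints (SmoothHypersurface.hypersurface F))}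
    (H : ∀ z, hypersurfacePoint (SmoothHypersurface.hypersurfaceι F) (g z) =
      hypersurfacePoint (SmoothHypersurface.hypersurfaceι F) (h z)) : g = h := by
  haveI := SmoothHypersurface.isClosedImmersion_hypersurfaceι_left F
  exact ContinuousMap.ext fun z =>
    (isEmbedding_hypersurfacePoint (SmoothHypersurface.hypersurfaceι F)).injective (H z)

/-- **On a fibre, the untwisting map is scaling by the parameter vector**: for `t ∈ B` and `y'` in the fibre over
`t`, the untwisted point has coordinates `[b(t) • z]`. [cite: Katz2009, §3] -/
theorem hypersurfacePoint_untwistC_fiberToTube (hF : F.IsHomogeneous d) (hd : 0 < d)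
    {t : ComplexPoints (torusBase d F)} (ht : t ∈ goodSet d F)
    (y' : ComplexPoints (fiberOver (torusFamily d F) t)) :
    hypersurfacePoint (SmoothHypersurface.hypersurfaceι F) ((untwistC hF hd).comp (fiberToTube (torusFamily d F) ht) y') =
      unitScale (paramUnits d F t ht) (totalProj d F (AlgPoints.map (fiberι (torusFamily d F) t) y')) := by
  change hypersurfacePoint _ (untwist hF hd (fiberToTube (torusFamily d F) ht y')) = _
  rw [hypersurfacePoint_untwist]
  have hpt : AlgPoints.map (torusFamily d F) (fiberToTube (torusFamily d F) ht y').1 = t :=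
    AlgPoints.map_map_fiberι _ _ _
  have key : ∀ (t₁ : ComplexPoints (torusBase d F)) (h₁ : t₁ ∈ goodSet d F) (e : t₁ = t),
      unitScale (paramUnits d F t₁ h₁) (totalProj d F (fiberToTube (torusFamily d F) ht y').1) =
        unitScale (paramUnits d F t ht) (totalProj d F (AlgPoints.map (fiberι (torusFamily d F) t) y')) := by
    intro t₁ h₁ e; subst e; rfl
  exact key _ _ hpt

end Coordinates

/-! ### §2 Transport along the torus path -/

section Transport

variable {n d : ℕ} {F : MvPolynomial (Fin (n + 2)) ℂ}
  (hF : F.IsHomogeneous d) (hJ : SmoothHypersurface.IsNonsingularForm ℂ F)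

/-- **An embedding-compatible identification `𝒴_{T,b} ≅ X_F` exists at every `b` with `F(b • x) = F`** (in
particular at `b = 1` and at every diagonal symmetry of `F`). [cite: VoisinHodgeII2003, §6.2.1] -/
theorem exists_compatible_iso_torusPoint (hd : 1 ≤ d) (b : Fin (n + 2) → ℂˣ) (hb : aeval (diagonalSubst b) F = F) :
    ∃ e : fiberOver (torusFamily d F) (torusPoint hF hJ b) ≅ SmoothHypersurface.hypersurface F,
      e.hom ≫ SmoothHypersurface.hypersurfaceι F =
        fiberι (torusFamily d F) (torusPoint hF hJ b) ≫ totalToProjectiveSpace d F := by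
  obtain ⟨e₀, he₀⟩ := CyclicCoverScaling.exists_fiberIsoSpz_comp (by omega) (torusSpz d F) (torusPoint hF hJ b)
  have hG : pointFormSpz ℂ n d (torusSpz d F) (torusPoint hF hJ b) = F := by
    rw [pointFormSpz_torusPoint, hb]
  revert e₀ he₀
  generalize pointFormSpz ℂ n d (torusSpz d F) (torusPoint hF hJ b) = G at hG
  subst hG
  intro e₀ he₀
  exact ⟨e₀, he₀⟩

/-- **The monodromy of the torus path with complex coefficients.** For `a ∈ diagonalStabilizer F` and
embedding-compatible identifications `e₁ : 𝒴_{T,1} ≅ X_F`, `e₂ : 𝒴_{T,a} ≅ X_F`, parallel transport in `Rᵏ u_* ℂ`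
along the torus path `s ↦ b_s = exp(s·log a)` takes `e₁^* α` to `e₂^* (g_a^* α)` for every
`α ∈ Hᵏ(X_F(ℂ); ℂ)`: the transported classes are the restrictions of the tube class `untwist^* α`
(`transportFun_fiberRestrict`), and on the two end fibres the untwisting map is `e₁` (`b = 1`) resp. `g_a ∘ e₂`
(`b = a`). [cite: Katz2009, §3] [cite: VoisinHodgeII2003, §3.1.2] -/
theorem transportFun_torusPath (hn : 1 ≤ n) (hd : 1 ≤ d) {a : Fin (n + 2) → ℂˣ} (ha : a ∈ diagonalStabilizer F) (k : ℕ)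
    (e₁ : fiberOver (torusFamily d F) (torusPoint hF hJ 1) ≅ SmoothHypersurface.hypersurface F)
    (he₁ : e₁.hom ≫ SmoothHypersurface.hypersurfaceι F =
      fiberι (torusFamily d F) (torusPoint hF hJ 1) ≫ totalToProjectiveSpace d F)
    (e₂ : fiberOver (torusFamily d F) (torusPoint hF hJ a) ≅ SmoothHypersurface.hypersurface F)
    (he₂ : e₂.hom ≫ SmoothHypersurface.hypersurfaceι F =
      fiberι (torusFamily d F) (torusPoint hF hJ a) ≫ totalToProjectiveSpace d F)
    (α : complexBetti (SmoothHypersurface.hypersurface F) k) :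
    transportFun (torusFamily d F) k (torusFamily_locallyTrivial d F hn hd) ⟦torusPathUniv hF hJ a⟧
        (complexBetti.map e₁.hom k α) =
      complexBetti.map e₂.hom k (complexBetti.map (diagonalAut F ha) k α) := by
  have hd' : 0 < d := by omega
  set B := goodSet d F with hB
  have hBo : IsOpen B := isOpen_goodSet d F
  have hs₁ : torusPoint hF hJ 1 ∈ B := torusPoint_mem_goodSet hF hJ 1
  have hs₂ : torusPoint hF hJ a ∈ B := torusPoint_mem_goodSet hF hJ a
  have hγ : ∀ u, (torusPathUniv hF hJ a u).1 ∈ B := fun u => by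
    rw [torusPathUniv_apply]; exact torusPoint_mem_goodSet hF hJ _
  set Θ := untwistC hF hd' with hΘ
  set ξ : singularCohomology ℂ ℂ (tubeOver (torusFamily d F) B) k := singularCohomology.map ℂ ℂ Θ k α with hξ
  have hres : ∀ {t} (ht : t ∈ B), fiberRestrict (torusFamily d F) ht k ξ =
      singularCohomology.map ℂ ℂ (Θ.comp (fiberToTube (torusFamily d F) ht)) k α := fun ht => by
    rw [fiberRestrict, hξ, singularCohomology.map_comp, ModuleCat.comp_apply]
  -- on the fibre `b = 1`: `Θ ∘ incl = e₁`
  have hstart : Θ.comp (fiberToTube (torusFamily d F) hs₁) = AlgPoints.mapContinuous (L := ℂ) e₁.hom := by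
    refine continuousMap_eq_of_hypersurfacePoint_eq fun y' => ?_
    rw [hΘ, hypersurfacePoint_untwistC_fiberToTube, paramUnits_torusPoint, unitScale_one, totalProj,
      ← hypersurfacePoint_comp, ← he₁, hypersurfacePoint_comp]
    rfl
  -- on the fibre `b = a`: `Θ ∘ incl = g_a ∘ e₂`
  have hend : Θ.comp (fiberToTube (torusFamily d F) hs₂) =
      (diagonalMap F ha).comp (AlgPoints.mapContinuous (L := ℂ) e₂.hom) := by
    refine continuousMap_eq_of_hypersurfacePoint_eq fun y' => ?_
    rw [hΘ, hypersurfacePoint_untwistC_fiberToTube, paramUnits_torusPoint, ContinuousMap.comp_apply,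
      hypersurfacePoint_diagonalMap, totalProj, ← hypersurfacePoint_comp, ← he₂, hypersurfacePoint_comp]
    rfl
  have h1 : complexBetti.map e₁.hom k α = fiberRestrict (torusFamily d F) hs₁ k ξ := by
    rw [hres hs₁, hstart]
  rw [h1, transportFun_fiberRestrict (torusFamily d F) k (torusFamily_locallyTrivial d F hn hd) hBo
    (torusPathUniv hF hJ a) hγ hs₁ hs₂ ξ, hres hs₂, hend, singularCohomology.map_comp, ModuleCat.comp_apply]
  rfl

end Transport

end DiagonalTorus

end Literature.AlgebraicGeometry.HodgeTheory

end
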